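import Literature.InformationTheory.Entanglement.TwoRebitSeparabilityProbability
import Mathlib.MeasureTheory.Measure.Lebesgue.EqHaar
import HarnessLib

/-!
# Two-rebit separability probability on a fibre: invariance over the reduced state

Lovas–Andai 2017 (J. Phys. A 50, 295303 = arXiv:1610.01410), Corollary 2, contains two assertions
about the fibre `D_{4,ℝ}(D) = {ρ | Tr₂ ρ = D}` of two-rebit states over a faithful reduced state
`D ∈ D_{2,ℝ}`: (i) the Hilbert–Schmidt separability probability of the fibre "is not depend on `D`,
that proves the conjecture of Milz and Strunz", and (ii) (with Theorem 2) its value is `29/64`.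
The named fact `LovasAndai2017_rebit_fibre_2964` (file `TwoRebitSeparabilityProbability`) records
both at once. This file PROVES (i) and reduces the fact to the single central computation (ii):

* `rebitFibre_volume_mul_volume_comm` — for faithful `D, D'`,
  `λ₇(P_ℝ(D)) · λ₇(D_ℝ(D')) = λ₇(P_ℝ(D')) · λ₇(D_ℝ(D))` (the ratio is independent of `D`);
* `LovasAndai2017_rebit_fibre_2964_iff_one` — the fact is equivalent to the one identity
  `64 · λ₇(P_ℝ(𝟙)) = 29 · λ₇(D_ℝ(𝟙))` on the fibre over `D = 𝟙` (any fixed faithful fibre would do).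

## The argument (a shorter road than the printed one)

Lovas–Andai obtain (i) at the end of the proof of Theorem 1 by the substitutions
`C = D₁^{1/2} X D₂^{1/2}`, `Y = D^{-1/2} A D^{-1/2}` and the singular-value bookkeeping of Lemmas 2–5.
Here we use directly the local congruence `ρ ↦ G ρ Gᵀ`, `G = M ⊕ M = 𝟙 ⊗ M` (`M ∈ GL₂(ℝ)`): in the
fibre chart `x ↦ ρ_D(x) = [[X, Z], [Zᵀ, D − X]]` it acts by the LINEAR map
`Φ_M : (X, Z) ↦ (M X Mᵀ, M Z Mᵀ)` of `ℝ⁷` and `ρ_{M D Mᵀ}(Φ_M x) = G ρ_D(x) Gᵀ`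
(`rebitFibreDensity_congr`); since the partial transpose swaps the off-diagonal blocks it commutes
with `G (·) Gᵀ` (`rebitFibreDensityPT_congr`). Congruence by an invertible matrix preserves
positive semidefiniteness both ways, so `D_ℝ(D) = Φ_M⁻¹(D_ℝ(M D Mᵀ))` and
`P_ℝ(D) = Φ_M⁻¹(P_ℝ(M D Mᵀ))`, and Lebesgue measure scales both by the same factor
`|det Φ_M|⁻¹ ∈ (0, ∞)` (`MeasureTheory.Measure.addHaar_preimage_linearMap`). Finally every
positive definite `2 × 2` real `D` is congruent to `𝟙` by an explicit inverse Cholesky factor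
(`exists_isUnit_conj_eq_one`). This is the real-rebit instance of the familiar remark that local
filtering `ρ ↦ (𝟙 ⊗ M) ρ (𝟙 ⊗ M)ᵀ` preserves both positivity and the PPT property.

## Not here

The value (ii) on one fibre (Lovas–Andai's Theorem 2 proper: Lemma 6 / Appendix A and the
dilogarithmic integral of the proof of Theorem 2); it is the hypothesis of
`LovasAndai2017_rebit_fibre_2964_of_one`.

## References

* [LovasAndai2017] A. Lovas, A. Andai, Invariance of separability probability over reduced states
  in 4 × 4 bipartite systems, J. Phys. A 50 (2017) 295303, §3: Theorem 1 (proof), Corollary 2,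
  Theorem 2.
* [MilzStrunz2014] S. Milz, W. T. Strunz, Volumes of conditioned bipartite state spaces,
  J. Phys. A 48 (2015) 035306 (the conjecture).
-/

noncomputable section

open MeasureTheory Set
open scoped ENNReal Matrix

namespace Literature.InformationTheory.Entanglement

/-! ### The local operator `M ⊕ M` and the induced linear map of the fibre chart -/

/-- The block-diagonal `4 × 4` matrix `M ⊕ M = 𝟙 ⊗ M` (the same `2 × 2` matrix `M` acting inside
each of the two blocks of the chart `[[X, Z], [Zᵀ, D − X]]`). [folklore] -/
def rebitLocalOp (M : Matrix (Fin 2) (Fin 2) ℝ) : Matrix (Fin 4) (Fin 4) ℝ :=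
  !![M 0 0, M 0 1, 0, 0; M 1 0, M 1 1, 0, 0; 0, 0, M 0 0, M 0 1; 0, 0, M 1 0, M 1 1]

/-- `M ↦ M ⊕ M` is multiplicative. [folklore] -/
theorem rebitLocalOp_mul (M N : Matrix (Fin 2) (Fin 2) ℝ) :
    rebitLocalOp (M * N) = rebitLocalOp M * rebitLocalOp N := by
  ext i j
  fin_cases i <;> fin_cases j <;>
    simp [rebitLocalOp, Matrix.mul_apply, Fin.sum_univ_four, Fin.sum_univ_two]

/-- `𝟙 ⊕ 𝟙 = 𝟙`. [folklore] -/
theorem rebitLocalOp_one : rebitLocalOp 1 = (1 : Matrix (Fin 4) (Fin 4) ℝ) := by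
  ext i j
  fin_cases i <;> fin_cases j <;> simp [rebitLocalOp]

/-- `(M ⊕ M)ᵀ = Mᵀ ⊕ Mᵀ`. [folklore] -/
theorem rebitLocalOp_transpose (M : Matrix (Fin 2) (Fin 2) ℝ) :
    (rebitLocalOp M)ᵀ = rebitLocalOp Mᵀ := by
  ext i j
  fin_cases i <;> fin_cases j <;> simp [rebitLocalOp]

/-- `M ⊕ M` is invertible when `M` is. [folklore] -/
theorem isUnit_rebitLocalOp {M : Matrix (Fin 2) (Fin 2) ℝ} (hM : IsUnit M) :
    IsUnit (rebitLocalOp M) := by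
  obtain ⟨u, rfl⟩ := hM
  refine ⟨⟨rebitLocalOp (u : Matrix (Fin 2) (Fin 2) ℝ),
    rebitLocalOp ((u⁻¹ : (Matrix (Fin 2) (Fin 2) ℝ)ˣ) : Matrix (Fin 2) (Fin 2) ℝ), ?_, ?_⟩, rfl⟩
  · rw [← rebitLocalOp_mul, Units.mul_inv, rebitLocalOp_one]
  · rw [← rebitLocalOp_mul, Units.inv_mul, rebitLocalOp_one]

/-- Congruence by the invertible local operator `M ⊕ M` preserves and reflects positive
semidefiniteness: `(M ⊕ M) A (M ⊕ M)ᵀ ≽ 0 ↔ A ≽ 0`. [folklore] -/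
theorem posSemidef_rebitLocalOp_conj_iff {M : Matrix (Fin 2) (Fin 2) ℝ} (hM : IsUnit M)
    (A : Matrix (Fin 4) (Fin 4) ℝ) :
    (rebitLocalOp M * A * (rebitLocalOp M)ᵀ).PosSemidef ↔ A.PosSemidef := by
  have h := Matrix.IsUnit.posSemidef_star_right_conjugate_iff (x := A) (isUnit_rebitLocalOp hM)
  rwa [Matrix.star_eq_conjTranspose, Matrix.conjTranspose_eq_transpose_of_trivial] at h

/-- **The linear map `Φ_M` of the fibre chart induced by the local congruence.** In the
coordinates `x ↦ (X, Z)`, `X = [[x0, x2], [x2, x1]]`, `Z = [[x3, x4], [x5, x6]]` of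
`rebitFibreDensity`, `Φ_M x` is the coordinate vector of `(M X Mᵀ, M Z Mᵀ)` (written out as
explicit linear forms; `rebitFibreDensity_congr` certifies the formula). [folklore] -/
def rebitFibreCongr (M : Matrix (Fin 2) (Fin 2) ℝ) : (Fin 7 → ℝ) →ₗ[ℝ] (Fin 7 → ℝ) where
  toFun x :=
    ![M 0 0 * M 0 0 * x 0 + 2 * M 0 0 * M 0 1 * x 2 + M 0 1 * M 0 1 * x 1,
      M 1 0 * M 1 0 * x 0 + 2 * M 1 0 * M 1 1 * x 2 + M 1 1 * M 1 1 * x 1,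
      M 0 0 * M 1 0 * x 0 + (M 0 0 * M 1 1 + M 0 1 * M 1 0) * x 2 + M 0 1 * M 1 1 * x 1,
      M 0 0 * M 0 0 * x 3 + M 0 0 * M 0 1 * x 4 + M 0 1 * M 0 0 * x 5 + M 0 1 * M 0 1 * x 6,
      M 0 0 * M 1 0 * x 3 + M 0 0 * M 1 1 * x 4 + M 0 1 * M 1 0 * x 5 + M 0 1 * M 1 1 * x 6,
      M 1 0 * M 0 0 * x 3 + M 1 0 * M 0 1 * x 4 + M 1 1 * M 0 0 * x 5 + M 1 1 * M 0 1 * x 6,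
      M 1 0 * M 1 0 * x 3 + M 1 0 * M 1 1 * x 4 + M 1 1 * M 1 0 * x 5 + M 1 1 * M 1 1 * x 6]
  map_add' x y := by
    ext i
    fin_cases i <;> simp <;> ring
  map_smul' c x := by
    ext i
    fin_cases i <;> simp <;> ring

/-- Unfolding of `Φ_M`. [folklore] -/
@[simp] theorem rebitFibreCongr_apply (M : Matrix (Fin 2) (Fin 2) ℝ) (x : Fin 7 → ℝ) :
    rebitFibreCongr M x =
    ![M 0 0 * M 0 0 * x 0 + 2 * M 0 0 * M 0 1 * x 2 + M 0 1 * M 0 1 * x 1,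
      M 1 0 * M 1 0 * x 0 + 2 * M 1 0 * M 1 1 * x 2 + M 1 1 * M 1 1 * x 1,
      M 0 0 * M 1 0 * x 0 + (M 0 0 * M 1 1 + M 0 1 * M 1 0) * x 2 + M 0 1 * M 1 1 * x 1,
      M 0 0 * M 0 0 * x 3 + M 0 0 * M 0 1 * x 4 + M 0 1 * M 0 0 * x 5 + M 0 1 * M 0 1 * x 6,
      M 0 0 * M 1 0 * x 3 + M 0 0 * M 1 1 * x 4 + M 0 1 * M 1 0 * x 5 + M 0 1 * M 1 1 * x 6,
      M 1 0 * M 0 0 * x 3 + M 1 0 * M 0 1 * x 4 + M 1 1 * M 0 0 * x 5 + M 1 1 * M 0 1 * x 6,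
      M 1 0 * M 1 0 * x 3 + M 1 0 * M 1 1 * x 4 + M 1 1 * M 1 0 * x 5 + M 1 1 * M 1 1 * x 6] :=
  rfl

/-- **The chart intertwines `Φ_M` with the congruence**: `ρ_{M D Mᵀ}(Φ_M x) = (M ⊕ M) ρ_D(x) (M ⊕ M)ᵀ`
(blockwise: `M X Mᵀ`, `M Z Mᵀ`, `(M Z Mᵀ)ᵀ = M Zᵀ Mᵀ`, `M (D − X) Mᵀ = M D Mᵀ − M X Mᵀ`).
[cite: LovasAndai2017, §3 (proof of Theorem 1: the substitutions C = D₁^{1/2} X D₂^{1/2}, Y = D^{-1/2} A D^{-1/2})] -/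
theorem rebitFibreDensity_congr (M D : Matrix (Fin 2) (Fin 2) ℝ) (x : Fin 7 → ℝ) :
    rebitFibreDensity (M * D * Mᵀ) (rebitFibreCongr M x) =
      rebitLocalOp M * rebitFibreDensity D x * (rebitLocalOp M)ᵀ := by
  ext i j
  fin_cases i <;> fin_cases j <;>
    simp [rebitFibreDensity, rebitLocalOp, Matrix.mul_apply, Fin.sum_univ_four,
      Fin.sum_univ_two] <;> ring

/-- The same intertwining for the partial transposes: `ρ^Γ_{M D Mᵀ}(Φ_M x) = (M ⊕ M) ρ^Γ_D(x) (M ⊕ M)ᵀ`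
(the partial transpose swaps the off-diagonal blocks, which commutes with applying the same
congruence to every block — local operations preserve the PPT property).
[cite: LovasAndai2017, §3 (the involution T and the proof of Theorem 1)] -/
theorem rebitFibreDensityPT_congr (M D : Matrix (Fin 2) (Fin 2) ℝ) (x : Fin 7 → ℝ) :
    rebitFibreDensityPT (M * D * Mᵀ) (rebitFibreCongr M x) =
      rebitLocalOp M * rebitFibreDensityPT D x * (rebitLocalOp M)ᵀ := by
  ext i j
  fin_cases i <;> fin_cases j <;>
    simp [rebitFibreDensityPT, rebitLocalOp, Matrix.mul_apply, Fin.sum_univ_four,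
      Fin.sum_univ_two] <;> ring

/-- Functoriality: `Φ_{M N} = Φ_M ∘ Φ_N`. [folklore] -/
theorem rebitFibreCongr_mul (M N : Matrix (Fin 2) (Fin 2) ℝ) (x : Fin 7 → ℝ) :
    rebitFibreCongr (M * N) x = rebitFibreCongr M (rebitFibreCongr N x) := by
  ext i
  fin_cases i <;> simp [Matrix.mul_apply, Fin.sum_univ_two] <;> ring

/-- `Φ_𝟙 = id`. [folklore] -/
theorem rebitFibreCongr_one_apply (x : Fin 7 → ℝ) :
    rebitFibreCongr (1 : Matrix (Fin 2) (Fin 2) ℝ) x = x := by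
  ext i
  fin_cases i <;> simp

/-- `Φ_M` has non-zero determinant for invertible `M` (its inverse is `Φ_{M⁻¹}`). [folklore] -/
theorem det_rebitFibreCongr_ne_zero {M : Matrix (Fin 2) (Fin 2) ℝ} (hM : IsUnit M) :
    LinearMap.det (rebitFibreCongr M) ≠ 0 := by
  obtain ⟨u, rfl⟩ := hM
  have h : rebitFibreCongr ((u⁻¹ : (Matrix (Fin 2) (Fin 2) ℝ)ˣ) : Matrix (Fin 2) (Fin 2) ℝ) ∘ₗ
      rebitFibreCongr (u : Matrix (Fin 2) (Fin 2) ℝ) = LinearMap.id := by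
    apply LinearMap.ext
    intro x
    rw [LinearMap.comp_apply, ← rebitFibreCongr_mul, Units.inv_mul, rebitFibreCongr_one_apply,
      LinearMap.id_apply]
  have hdet := congrArg LinearMap.det h
  rw [LinearMap.det_comp, LinearMap.det_id] at hdet
  intro h0
  rw [h0, mul_zero] at hdet
  exact zero_ne_one hdet

/-! ### The bodies over congruent reduced states are linear images of each other -/

/-- `Φ_M x ∈ D_ℝ(M D Mᵀ) ↔ x ∈ D_ℝ(D)` for invertible `M`.
[cite: LovasAndai2017, §3 (proof of Theorem 1)] -/
theorem rebitFibreCongr_mem_rebitFibreBody_iff {M : Matrix (Fin 2) (Fin 2) ℝ} (hM : IsUnit M)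
    (D : Matrix (Fin 2) (Fin 2) ℝ) (x : Fin 7 → ℝ) :
    rebitFibreCongr M x ∈ rebitFibreBody (M * D * Mᵀ) ↔ x ∈ rebitFibreBody D := by
  simp only [rebitFibreBody, mem_setOf_eq, rebitFibreDensity_congr]
  exact posSemidef_rebitLocalOp_conj_iff hM _

/-- `Φ_M x ∈ P_ℝ(M D Mᵀ) ↔ x ∈ P_ℝ(D)` for invertible `M` (local operations preserve PPT).
[cite: LovasAndai2017, §3 (proof of Theorem 1)] -/
theorem rebitFibreCongr_mem_rebitFibrePPTBody_iff {M : Matrix (Fin 2) (Fin 2) ℝ} (hM : IsUnit M)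
    (D : Matrix (Fin 2) (Fin 2) ℝ) (x : Fin 7 → ℝ) :
    rebitFibreCongr M x ∈ rebitFibrePPTBody (M * D * Mᵀ) ↔ x ∈ rebitFibrePPTBody D := by
  simp only [rebitFibrePPTBody, mem_setOf_eq, rebitFibreDensity_congr, rebitFibreDensityPT_congr]
  exact and_congr (posSemidef_rebitLocalOp_conj_iff hM _) (posSemidef_rebitLocalOp_conj_iff hM _)

/-- `D_ℝ(D) = Φ_M⁻¹(D_ℝ(M D Mᵀ))`. [cite: LovasAndai2017, §3 (proof of Theorem 1)] -/
theorem rebitFibreBody_eq_preimage {M : Matrix (Fin 2) (Fin 2) ℝ} (hM : IsUnit M)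
    (D : Matrix (Fin 2) (Fin 2) ℝ) :
    rebitFibreBody D = rebitFibreCongr M ⁻¹' rebitFibreBody (M * D * Mᵀ) := by
  ext x
  exact (rebitFibreCongr_mem_rebitFibreBody_iff hM D x).symm

/-- `P_ℝ(D) = Φ_M⁻¹(P_ℝ(M D Mᵀ))`. [cite: LovasAndai2017, §3 (proof of Theorem 1)] -/
theorem rebitFibrePPTBody_eq_preimage {M : Matrix (Fin 2) (Fin 2) ℝ} (hM : IsUnit M)
    (D : Matrix (Fin 2) (Fin 2) ℝ) :
    rebitFibrePPTBody D = rebitFibreCongr M ⁻¹' rebitFibrePPTBody (M * D * Mᵀ) := by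
  ext x
  exact (rebitFibreCongr_mem_rebitFibrePPTBody_iff hM D x).symm

/-- **Volume scaling of the fibre body under a local congruence**:
`λ₇(D_ℝ(D)) = |det Φ_M|⁻¹ · λ₇(D_ℝ(M D Mᵀ))`.
[cite: LovasAndai2017, §3 (proof of Theorem 1, Jacobians det(D₁D₂)^d and det(D)^{2d−d²/2})] -/
theorem volume_rebitFibreBody_congr {M : Matrix (Fin 2) (Fin 2) ℝ} (hM : IsUnit M)
    (D : Matrix (Fin 2) (Fin 2) ℝ) :
    volume (rebitFibreBody D) =
      ENNReal.ofReal |(LinearMap.det (rebitFibreCongr M))⁻¹| *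
        volume (rebitFibreBody (M * D * Mᵀ)) := by
  rw [rebitFibreBody_eq_preimage hM D]
  exact Measure.addHaar_preimage_linearMap volume (det_rebitFibreCongr_ne_zero hM) _

/-- **Volume scaling of the PPT fibre body under a local congruence** (same factor):
`λ₇(P_ℝ(D)) = |det Φ_M|⁻¹ · λ₇(P_ℝ(M D Mᵀ))`.
[cite: LovasAndai2017, §3 (proof of Theorem 1)] -/
theorem volume_rebitFibrePPTBody_congr {M : Matrix (Fin 2) (Fin 2) ℝ} (hM : IsUnit M)
    (D : Matrix (Fin 2) (Fin 2) ℝ) :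
    volume (rebitFibrePPTBody D) =
      ENNReal.ofReal |(LinearMap.det (rebitFibreCongr M))⁻¹| *
        volume (rebitFibrePPTBody (M * D * Mᵀ)) := by
  rw [rebitFibrePPTBody_eq_preimage hM D]
  exact Measure.addHaar_preimage_linearMap volume (det_rebitFibreCongr_ne_zero hM) _

/-- The cross-multiplied `29/64` identity transfers between congruent reduced states.
[cite: LovasAndai2017, Corollary 2] -/
theorem rebitFibre_identity_congr_iff {M : Matrix (Fin 2) (Fin 2) ℝ} (hM : IsUnit M)
    (D : Matrix (Fin 2) (Fin 2) ℝ) :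
    64 * volume (rebitFibrePPTBody D) = 29 * volume (rebitFibreBody D) ↔
      64 * volume (rebitFibrePPTBody (M * D * Mᵀ)) =
        29 * volume (rebitFibreBody (M * D * Mᵀ)) := by
  rw [volume_rebitFibreBody_congr hM D, volume_rebitFibrePPTBody_congr hM D]
  set c := ENNReal.ofReal |(LinearMap.det (rebitFibreCongr M))⁻¹| with hc
  have hc0 : c ≠ 0 := by
    rw [hc]
    have : 0 < |(LinearMap.det (rebitFibreCongr M))⁻¹| :=
      abs_pos.2 (inv_ne_zero (det_rebitFibreCongr_ne_zero hM))
    simpa only [ne_eq, ENNReal.ofReal_eq_zero, not_le] using this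
  have hct : c ≠ ⊤ := ENNReal.ofReal_ne_top
  rw [mul_left_comm 64 c, mul_left_comm 29 c]
  exact ENNReal.mul_right_inj hc0 hct

/-! ### Every faithful reduced state is congruent to `𝟙` (inverse Cholesky factor) -/

/-- For a positive definite real `2 × 2` matrix `D = [[a, b], [b, c]]` the Cholesky factor
`L = [[√a, 0], [b/√a, √Δ/√a]]`, `Δ = ac − b²`, satisfies `L Lᵀ = D` and is invertible, so
`M = L⁻¹` is invertible with `M D Mᵀ = 𝟙`. [folklore] -/
theorem exists_isUnit_conj_eq_one {D : Matrix (Fin 2) (Fin 2) ℝ} (hD : D.PosDef) :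
    ∃ M : Matrix (Fin 2) (Fin 2) ℝ, IsUnit M ∧ M * D * Mᵀ = 1 := by
  have ha : 0 < D 0 0 := hD.diag_pos
  have hsym : D 1 0 = D 0 1 := by
    have h := hD.isHermitian.apply 1 0
    simpa using h.symm
  have hΔ : 0 < D 0 0 * D 1 1 - D 0 1 * D 0 1 := by
    have hv : (![-D 0 1, D 0 0] : Fin 2 → ℝ) ≠ 0 := by
      intro h
      have h1 := congrFun h 1
      simp at h1
      exact ha.ne' h1
    have hq := hD.dotProduct_mulVec_pos hv
    simp [Matrix.mulVec, dotProduct, Fin.sum_univ_two, hsym] at hq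
    nlinarith [hq, ha]
  set s := Real.sqrt (D 0 0) with hs_def
  set r := Real.sqrt (D 0 0 * D 1 1 - D 0 1 * D 0 1) with hr_def
  have hs : s * s = D 0 0 := Real.mul_self_sqrt ha.le
  have hr : r * r = D 0 0 * D 1 1 - D 0 1 * D 0 1 := Real.mul_self_sqrt hΔ.le
  have hs0 : s ≠ 0 := (Real.sqrt_pos.2 ha).ne'
  have hr0 : r ≠ 0 := (Real.sqrt_pos.2 hΔ).ne'
  set L : Matrix (Fin 2) (Fin 2) ℝ := !![s, 0; D 0 1 / s, r / s] with hL_def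
  have hL : L * Lᵀ = D := by
    ext i j
    fin_cases i <;> fin_cases j
    · simp [L, Matrix.mul_apply, Fin.sum_univ_two]
      linear_combination hs
    · simp [L, Matrix.mul_apply, Fin.sum_univ_two]
      field_simp
    · simp [L, Matrix.mul_apply, Fin.sum_univ_two, hsym]
      field_simp
    · simp [L, Matrix.mul_apply, Fin.sum_univ_two]
      field_simp
      linear_combination hr - D 1 1 * hs
  have hLdet' : L.det = r := by
    rw [Matrix.det_fin_two]
    simp [L]
    field_simp
  have hLdet : IsUnit L.det := by
    rw [hLdet', isUnit_iff_ne_zero]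
    exact hr0
  have hLTdet : IsUnit Lᵀ.det := by rwa [Matrix.det_transpose]
  refine ⟨L⁻¹, Matrix.isUnit_nonsing_inv_iff.2 ((Matrix.isUnit_iff_isUnit_det L).2 hLdet), ?_⟩
  have h1 : L⁻¹ * L = 1 := Matrix.nonsing_inv_mul _ hLdet
  have h2 : Lᵀ * Lᵀ⁻¹ = 1 := Matrix.mul_nonsing_inv _ hLTdet
  rw [← hL, Matrix.transpose_nonsing_inv]
  calc L⁻¹ * (L * Lᵀ) * Lᵀ⁻¹ = (L⁻¹ * L) * (Lᵀ * Lᵀ⁻¹) := by simp only [mul_assoc]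
    _ = 1 := by rw [h1, h2, one_mul]

/-- `√2 · 𝟙` is invertible and conjugates the maximally mixed qubit `½ · 𝟙` to `𝟙`. [folklore] -/
theorem sqrt_two_smul_one_conj_half :
    IsUnit (Real.sqrt 2 • (1 : Matrix (Fin 2) (Fin 2) ℝ)) ∧
      Real.sqrt 2 • (1 : Matrix (Fin 2) (Fin 2) ℝ) * ((2 : ℝ)⁻¹ • (1 : Matrix (Fin 2) (Fin 2) ℝ)) *
        (Real.sqrt 2 • (1 : Matrix (Fin 2) (Fin 2) ℝ))ᵀ = 1 := by
  have h2 : Real.sqrt 2 * Real.sqrt 2 = 2 := Real.mul_self_sqrt (by norm_num)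
  have h0 : Real.sqrt 2 ≠ 0 := (Real.sqrt_pos.2 (by norm_num)).ne'
  constructor
  · rw [Matrix.isUnit_iff_isUnit_det, Matrix.det_smul, Matrix.det_one, isUnit_iff_ne_zero]
    simp
  · rw [Matrix.transpose_smul, Matrix.transpose_one, smul_mul_smul, mul_one, smul_mul_smul,
      mul_one]
    have : Real.sqrt 2 * 2⁻¹ * Real.sqrt 2 = 1 := by nlinarith [h2]
    rw [this, one_smul]

/-! ### Corollary 2 (i): invariance over the reduced state; reduction of the fact to one fibre -/

/-- **Lovas–Andai 2017, Corollary 2 (the Milz–Strunz conjecture, real case), proved**: the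
Hilbert–Schmidt separability (= PPT) probability of the fibre `D_{4,ℝ}(D)` does not depend on the
faithful reduced state `D`; in cross-multiplied form for the closed bodies of the chart,
`λ₇(P_ℝ(D)) · λ₇(D_ℝ(D')) = λ₇(P_ℝ(D')) · λ₇(D_ℝ(D))` for all positive definite `D, D'`
(no trace normalisation is needed). [cite: LovasAndai2017, Corollary 2] -/
theorem rebitFibre_volume_mul_volume_comm {D D' : Matrix (Fin 2) (Fin 2) ℝ} (hD : D.PosDef)
    (hD' : D'.PosDef) :
    volume (rebitFibrePPTBody D) * volume (rebitFibreBody D') =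
      volume (rebitFibrePPTBody D') * volume (rebitFibreBody D) := by
  obtain ⟨M, hM, hMD⟩ := exists_isUnit_conj_eq_one hD
  obtain ⟨M', hM', hMD'⟩ := exists_isUnit_conj_eq_one hD'
  rw [volume_rebitFibreBody_congr hM D, volume_rebitFibrePPTBody_congr hM D, hMD,
    volume_rebitFibreBody_congr hM' D', volume_rebitFibrePPTBody_congr hM' D', hMD']
  ring

/-- **Reduction of the fibre fact to the fibre over `𝟙`**: if
`64 · λ₇(P_ℝ(𝟙)) = 29 · λ₇(D_ℝ(𝟙))`, then `64 · λ₇(P_ℝ(D)) = 29 · λ₇(D_ℝ(D))` for every faithful `D`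
(Lovas–Andai's Theorem 2 on one fibre gives it on all fibres, by Corollary 2 (i)).
[cite: LovasAndai2017, Corollary 2 and Theorem 2] -/
theorem LovasAndai2017_rebit_fibre_2964_of_one
    (h : 64 * volume (rebitFibrePPTBody (1 : Matrix (Fin 2) (Fin 2) ℝ)) =
      29 * volume (rebitFibreBody (1 : Matrix (Fin 2) (Fin 2) ℝ))) :
    LovasAndai2017_rebit_fibre_2964 := by
  intro D hD _
  obtain ⟨M, hM, hMD⟩ := exists_isUnit_conj_eq_one hD
  rw [rebitFibre_identity_congr_iff hM D, hMD]
  exact h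

/-- **The fibre fact is equivalent to the single identity on the fibre over `𝟙`**
(`⇒`: apply the fact at the maximally mixed qubit `½ · 𝟙 ∈ D_{2,ℝ}` and conjugate by `√2 · 𝟙`).
[cite: LovasAndai2017, Corollary 2 and Theorem 2] -/
theorem LovasAndai2017_rebit_fibre_2964_iff_one :
    LovasAndai2017_rebit_fibre_2964 ↔
      64 * volume (rebitFibrePPTBody (1 : Matrix (Fin 2) (Fin 2) ℝ)) =
        29 * volume (rebitFibreBody (1 : Matrix (Fin 2) (Fin 2) ℝ)) := by
  refine ⟨fun h => ?_, LovasAndai2017_rebit_fibre_2964_of_one⟩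
  have h2 := h _ half_posDef_and_trace.1 half_posDef_and_trace.2
  rw [rebitFibre_identity_congr_iff sqrt_two_smul_one_conj_half.1,
    sqrt_two_smul_one_conj_half.2] at h2
  exact h2

end Literature.InformationTheory.Entanglement

end
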